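/-
Copyright (c) 2026 the pub-hodgecm-mathlib formalisation cell (harness21).  Prover seat hodgecm-mathlib-K2E5-p10 (g4), Track B «K2-LIT» ∕ h413
(`stmt-HodgeConjecture-24833`), line `K2_E3_EllipticInputs`, unit U12, §L: THE LEAF (LBGL-2b) `sig_K2E3GL2RegularNilpotentFourier` PAID BY NAME — the Fourier
transform of the regular nilpotent orbital measure of `𝔤𝔩₂(F)` is a locally integrable, `|disc|^{1∕2}`-bounded, regular-locally-constant function.  2026-09-04.
-/
import Summits.HodgeConjecture.HodgeConjecture.Theorems.K2E3GL2RegularNilpotentFourierOfSliceDensity   -- ★ p857004 (K2E5-p17 (g3)): the assembly over a Borel-slice density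
import Summits.HodgeConjecture.HodgeConjecture.Theorems.K2E3GL2BorelSliceDensity                      -- ★ (this seat): `exists_borelSliceDensity` (b-ii)
import HarnessLib

/-!
# K2_E3 road (h413), §L — the leaf (LBGL-2b) paid by name: regularity of `μ̂_reg` on `𝔤𝔩₂(F)`

Cell `pub/hodgecm-mathlib` (D-0151), Track B, seat K2E5-p10 (g4) (free E5 hand on the E3 §L line; §L lead K2E3-p12 (g4), dealer K2E3-plan (g2)).
`--supports stmt-HodgeConjecture-24833 --as helper`; THEOREMS ONLY (no definition ∕ instance ∕ notation ∕ named fact ∕ `sorry`); never imports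
`Cruxes/…/Lines`.  The statement below is the U12 ED. 9 socket `sig_K2E3GL2RegularNilpotentFourier` (:607) TOKEN FOR TOKEN; the dealer re-ties the
socket `:= K2E3GL2RegularNilpotentFourier.gl2RegularNilpotentFourier` after a `type_of%` probe.  COUNT-NEUTRAL until the re-tie; (L-B_GL) :478 then
holds at `N = 2` modulo (LBGL-2a) alone.

THE RESULT **`gl2RegularNilpotentFourier`**: for every non-archimedean local field `F` of characteristic `0`, continuous non-trivial `ψ`, additive Haar `μ𝔤`
on `𝔤𝔩₂(F)`, Haar `κ` on `K = GL₂(𝒪)` and additive Haar `dx` on `F`, the functional `f ↦ μ_reg(𝓕_ψ f) = ∫_{K×F} 𝓕_ψ f(k (tE₁₂) k⁻¹) d(κ ⊗ dx)` is represented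
by a locally integrable `F_reg`, locally constant on `{disc χ ≠ 0}`, with `|disc χ|^{1∕2}·|F_reg|` locally bounded — Harish-Chandra's Thm. 4.4 for the
regular nilpotent orbit of `𝔤𝔩₂`, with the explicit `F_reg = c·1[disc χ ∈ (Fˣ)²]·|disc χ|^{-1∕2}`.  Proof = ★ p857004
`gl2RegularNilpotentFourier_of_forall_sliceDensity` (line Fourier inversion ★ p856988 (b-i) + assembly) applied to ★ `exists_borelSliceDensity` (b-ii):
the Lie–Weyl formula for the Borel slice (★ p857064 p857076 squaring push-forward, ★ p857112 lower cell, ★ p857069∕p857099 Bruhat cells of `GL₂(𝒪)`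
(K2E5-p17 (g3)), ★ p857153 `K`-integral, ★ p857186 density; ★ p856597 `|disc|^{-1∕2} ∈ L¹_loc` (K2E3-p12 (g3))).
[HarishChandra1999AdmissibleDistributions, Thm. 4.4 p. 11, Lemma 7.8] [Howe1974, Prop. 3]
HONEST LABEL: HC_CM is proved only modulo the 7 printed citations (2 remaining named inputs: hLiu418 = stmt-HodgeConjecture-24832, h413 =
stmt-HodgeConjecture-24833) until rung 0 closes; count-neutral helper until the dealer re-ties the socket by name.

## References
* [HarishChandra1999AdmissibleDistributions] Harish-Chandra (DeBacker–Sally), *Admissible Invariant Distributions on Reductive p-adic Groups* (1999),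
  Thm. 4.4 p. 11, Lemma 7.8.
* [Howe1974] R. Howe, *The Fourier transform and germs of characters (case of `GL_n` over a `p`-adic field)*, Math. Ann. 208 (1974), Prop. 3.
-/

set_option autoImplicit false
set_option linter.dupNamespace false   -- `Summit.HodgeConjecture.HodgeConjecture.…` (D-0017 nested layout; lakefile exemption for Summits)

noncomputable section

open MeasureTheory Measure Filter Topology
open scoped MatrixGroups NNReal ENNReal
open Literature.NumberTheory.Rogawski1990 Literature.NumberTheory.Automorphic Literature.NumberTheory.Automorphic.LocalFieldHaar
open Literature.NumberTheory.GaloisRepresentations Literature.NumberTheory.GaloisRepresentations.IsNonarchimedeanLocalField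
open Summit.HodgeConjecture.HodgeConjecture.Cruxes.H413.K2E3GL2RegularNilpotentFourierOfSliceDensity
open Summit.HodgeConjecture.HodgeConjecture.Cruxes.H413.K2E3GL2BorelSliceDensity

namespace Summit.HodgeConjecture.HodgeConjecture.Cruxes.H413.K2E3GL2RegularNilpotentFourier

/-- **(LBGL-2b) PAID — HARISH-CHANDRA'S REGULARITY THEOREM FOR `μ̂_reg` ON `𝔤𝔩₂(F)`** (U12 ED. 9 socket `sig_K2E3GL2RegularNilpotentFourier`, token for
token): the Fourier transform of the regular nilpotent orbital measure `μ_reg` (Haar pair `(κ, dx)`, character `ψ`, any additive Haar `μ𝔤`) is represented by a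
locally integrable `F_reg`, locally constant on `{disc χ ≠ 0}`, with `|disc χ|_F^{1∕2}·|F_reg|` locally bounded (`F_reg = c·|disc χ|^{-1∕2}` on the split regular
semisimple set, `0` on the elliptic set).  `:=` ★ p857004 `gl2RegularNilpotentFourier_of_forall_sliceDensity` ∘ ★ `exists_borelSliceDensity`.
[cite: HarishChandra1999AdmissibleDistributions, Thm. 4.4 p. 11 (for `μ_reg`), Lemma 7.8] [cite: Howe1974, Prop. 3] -/
theorem gl2RegularNilpotentFourier :
    ∀ (F : Type) [Field F] [ValuativeRel F] [TopologicalSpace F] [IsNonarchimedeanLocalField F] [CharZero F]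
      (ψ : AddChar F Circle), ψ.IsContinuousNontrivial →
      ∀ [MeasurableSpace (Matrix (Fin 2) (Fin 2) F)] [BorelSpace (Matrix (Fin 2) (Fin 2) F)] (μ𝔤 : Measure (Matrix (Fin 2) (Fin 2) F)) [μ𝔤.IsAddHaarMeasure]
        [MeasurableSpace F] [BorelSpace F] [MeasurableSpace (GL (Fin 2) F)] [BorelSpace (GL (Fin 2) F)]
        (κ : Measure ↥(glInt 2 F)) [IsHaarMeasure κ] (dx : Measure F) [dx.IsAddHaarMeasure],
      ∃ Fr : Matrix (Fin 2) (Fin 2) F → ℂ, LocallyIntegrable Fr μ𝔤 ∧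
        (∀ f : Matrix (Fin 2) (Fin 2) F → ℂ, IsLocSmooth f →
          ∫ p : ↥(glInt 2 F) × F, (fun Y : Matrix (Fin 2) (Fin 2) F => ∫ X, ((ψ (Matrix.trace (Y * X)) : Circle) : ℂ) * f X ∂μ𝔤)
              (((p.1 : GL (Fin 2) F) : Matrix (Fin 2) (Fin 2) F) * !![0, p.2; 0, 0] * ((((p.1 : GL (Fin 2) F))⁻¹ : GL (Fin 2) F) : Matrix (Fin 2) (Fin 2) F)) ∂(κ.prod dx) =
            ∫ X, f X * Fr X ∂μ𝔤) ∧
        (∀ X : Matrix (Fin 2) (Fin 2) F, IsUnit X.charpoly.discr → ∀ᶠ Y in 𝓝 X, Fr Y = Fr X) ∧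
        (∀ C : Set (Matrix (Fin 2) (Fin 2) F), IsCompact C → ∃ B : ℝ, ∀ X ∈ C,
            ((NNReal.sqrt (normAbs F X.charpoly.discr) : ℝ≥0) : ℝ) * ‖Fr X‖ ≤ B) :=
  gl2RegularNilpotentFourier_of_forall_sliceDensity
    fun _ _ _ _ _ _ _ hψ _ _ μ𝔤 _ _ _ _ _ κ _ dx _ => exists_borelSliceDensity hψ μ𝔤 κ dx

end Summit.HodgeConjecture.HodgeConjecture.Cruxes.H413.K2E3GL2RegularNilpotentFourier

end
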